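import Mathlib
import Literature.Analysis.FluidPDE.ClassicalSolution
import Literature.Analysis.FluidPDE.LerayHopf
import Literature.Analysis.FluidPDE.NSSereginL3BlowupHolds
import Literature.Analysis.FluidPDE.NSCriticalClosureProofs
import Literature.Analysis.FluidPDE.NSCriticalClosureBesovKatoClass
import Literature.Analysis.FluidPDE.TaoLocalisationHolds
import Summits.NavierStokesRegularity.NavierStokesRegularity.Theses.L3TimeExponentPincer
import HarnessLib.Audit
import HarnessLib

/-!
# The known endpoint of the residual crux `SupercriticalSerrinL3` (route `L3TimeExponentPincer`,
# item `stmt-NavierStokesRegularity-19500`): `p = ∞` (Escauriaza–Seregin–Šverák 2003) and the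
# divergence `‖u(t)‖₃ → ∞` (Seregin 2012), as tree theorems in the route's exact frame

Support file (cell ns-regularity-ideate, seat p4, `--supports stmt-NavierStokesRegularity-19500 --as helper`).

The residual crux asks for SOME `p ∈ (4,5)` such that every frame solution (classical on `[0,T)`,
Leray–Hopf from a rapidly decaying datum) with `∫_{T₂}^{T} ‖u(t)‖₃^p dt < ∞` on a final window extends
smoothly past `T`.  In print the statement is known exactly at the endpoint `p = ∞`: `u ∈ L^∞(T₂,T; L³)`
forces continuation (Escauriaza–Seregin–Šverák 2003, Thms. 1.3–1.4), sharpened by Seregin 2012, Thm. 1.1: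
at a finite maximal time `‖u(t)‖_{L³} → ∞` (a genuine limit).  Both printed theorems are DISCHARGED
Literature facts of the tree (`seregin_L3_blowup_holds`, `ess_endpoint_holds`,
`hasSmoothExtensionPast_of_eLpNorm_three_bounded_holds`); this file is the frame glue that puts them in
the currency of the route (final windows `Ioo T₂ T`, the frame's four hypotheses, the tree's
Ladyzhenskaya–Prodi–Serrin class `MemLqLp ∞ 3`), with no symmetry hypothesis (the earlier Summits
instance `…CertifiedBlowupAxisymBlowup.CompactAmplification.tendsto_eLpNorm_three_nhdsLT_of_isMaximalSmoothSolution`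
assumed an axisymmetric datum for the closed-slab bounds; here they come from Tao 2013,
`eLpNorm_uncurry_top_lt_top_of_tao2011 tao2011_hasBoundedSobolevNormsOn_holds`).

* §1 Seregin 2012 for EVERY frame blow-up: `tendsto_eLpNorm_three_of_blowup`; window forms
  `eventually_lt_eLpNorm_three_of_blowup`, `exists_window_lt_eLpNorm_three_of_blowup` (for every level
  `c` a final window on which `c < ‖u(t)‖₃`) — the exponent-`0` instance, with ARBITRARY constant, of the
  floor shape of the registered stub `stub_l3RateFloor` of line `ratefloor` (which asks an exponent
  `θ₀ > 1/5`); it supersedes the fixed positive floor `eLpNorm_three_floor_of_blowup` (p425306).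
* §2 ESS in the frame, three spellings: `hasSmoothExtensionPast_of_frequently_eLpNorm_three_le`
  (liminf form = Seregin's contrapositive), `hasSmoothExtensionPast_of_eLpNorm_three_le_near` (a bound on a
  final window), `hasSmoothExtensionPast_of_memLqLp_top_three_near` (`u ∈ L^∞(T₂,T; L³)`, essential sup).
* §3 The RUNG: `supercriticalSerrinL3_rung_top` — the crux's text with the time exponent `p` replaced by
  `∞`, PROVED; `rung_top_of_supercriticalSerrinL3` — the crux implies the rung (an `L^∞` window bound gives
  every `L^p` window bound), i.e. the crux is a STRENGTHENING of a tree theorem from `p = ∞` to some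
  `p < 5` (BC5 witness-of-weakness shape for the residual conjunct; T3 of the tribunal).
  `not_memLqLp_top_three_near_of_blowup` is the blow-up reading.

WHAT THIS IS NOT: not a claim about Navier–Stokes regularity or blow-up and not progress on the crux
itself (`p < 5` stays open — it contains Type-I exclusion, `noTypeIBlowup_of_supercriticalSerrinL3`);
kernel-checked implications between typed tree predicates, landed `--supports`.

References: L. Escauriaza, G. Seregin, V. Šverák, Russ. Math. Surveys 58 (2003) 211–250, Thms. 1.3–1.4
[EscauriazaSereginSverak2003]; G. Seregin, Comm. Math. Phys. 312 (2012) 833–845, Thm. 1.1 [Seregin2012CMP];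
T. Tao, Anal. PDE 6 (2013) = arXiv:1108.1165, Cor. 11.1 [Tao2011]; P. G. Lemarié-Rieusset, *The
Navier–Stokes Problem in the 21st Century* (2016), Thm. 15.1, Thm. 15.5 [LemarieRieusset2016].
-/

noncomputable section

open MeasureTheory Set Function Filter Metric Topology
open scoped ENNReal NNReal Topology
open Literature.Analysis.FluidPDE
open Summit.NavierStokesRegularity.NavierStokesRegularity.Theses.L3TimeExponentPincer

namespace Summit.NavierStokesRegularity.NavierStokesRegularity.Theorems.L3TimeExponentPincerSerrinEndpointRung

variable {ν T : ℝ} {u : ℝ → EuclideanSpace ℝ (Fin 3) → EuclideanSpace ℝ (Fin 3)}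
  {p : ℝ → EuclideanSpace ℝ (Fin 3) → ℝ}

/-! ## §1  Seregin 2012 for every frame blow-up -/

/-- **Seregin's `L³` blow-up for EVERY frame blow-up** (Seregin 2012, Thm. 1.1 = the tree's discharged
`seregin_L3_blowup_holds`): a classical solution on `[0,T)`, Leray–Hopf from a rapidly decaying datum,
with no smooth extension past `T`, has `‖u(t)‖_{L³(ℝ³)} → ∞` as `t ↑ T` (genuine limit in `ℝ≥0∞`).  The
hypotheses of the Literature theorem are supplied from the frame: maximality is `⟨hcl, hnext⟩`, the datum
is an `L³` field because the solution is a Kato `C([0,T); L³)` solution (`isKatoSolutionOn_of_classical`,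
Lemarié-Rieusset 2016 Thm. 15.1), and essential boundedness on closed sub-strips is Tao 2013 Cor. 11.1
(`eLpNorm_uncurry_top_lt_top_of_tao2011`).  No symmetry assumption.
[cite: Seregin2012CMP, Thm. 1.1] [cite: LemarieRieusset2016, Thm. 15.5] -/
theorem tendsto_eLpNorm_three_of_blowup (hν : 0 < ν) (hT : 0 < T)
    (hcl : IsClassicalNSSolutionOn (Ico 0 T) ν 0 u p) (hLH : IsLerayHopfOn T ν 0 (u 0) u)
    (hdec : HasRapidSpatialDecay (u 0)) (hnext : ¬ HasSmoothExtensionPast ν 0 u T) :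
    Tendsto (fun t => eLpNorm (u t) 3 volume) (𝓝[<] T) (𝓝 ∞) :=
  seregin_L3_blowup_holds hν hT ⟨hcl, hnext⟩ hLH
    ((isKatoSolutionOn_of_classical hν hT hcl hLH hdec).memLp ⟨le_rfl, hT⟩)
    (eLpNorm_uncurry_top_lt_top_of_tao2011 tao2011_hasBoundedSobolevNormsOn_holds hν hcl hLH hdec)

/-- **Every finite level is eventually exceeded** at a frame blow-up: for `K < ∞`, `K < ‖u(t)‖₃` for all
`t < T` close to `T` (Seregin 2012, Thm. 1.1, `𝓝[<] T`-eventually form). [cite: Seregin2012CMP, Thm. 1.1] -/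
theorem eventually_lt_eLpNorm_three_of_blowup (hν : 0 < ν) (hT : 0 < T)
    (hcl : IsClassicalNSSolutionOn (Ico 0 T) ν 0 u p) (hLH : IsLerayHopfOn T ν 0 (u 0) u)
    (hdec : HasRapidSpatialDecay (u 0)) (hnext : ¬ HasSmoothExtensionPast ν 0 u T)
    {K : ℝ≥0∞} (hK : K < ∞) : ∀ᶠ t in 𝓝[<] T, K < eLpNorm (u t) 3 volume :=
  (tendsto_eLpNorm_three_of_blowup hν hT hcl hLH hdec hnext).eventually (eventually_gt_nhds hK)

/-- **Final-window form of Seregin's divergence**: for every real level `c` there is `T₁ ∈ [0,T)` with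
`c < ‖u(t)‖_{L³}` for all `t ∈ (T₁, T)`.  This is the floor shape
`ofReal (c · (T-t)^{-θ₀}) ≤ ‖u(t)‖₃` of the registered stub `stub_l3RateFloor` (line `ratefloor` of the
residual crux) at the exponent `θ₀ = 0` and with ARBITRARY constant `c` — the strongest floor in print
(the stub asks `θ₀ > 1/5`; Tao 2019 gives only a triple-logarithmic rate for the `limsup`).
[cite: Seregin2012CMP, Thm. 1.1] -/
theorem exists_window_lt_eLpNorm_three_of_blowup (hν : 0 < ν) (hT : 0 < T)
    (hcl : IsClassicalNSSolutionOn (Ico 0 T) ν 0 u p) (hLH : IsLerayHopfOn T ν 0 (u 0) u)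
    (hdec : HasRapidSpatialDecay (u 0)) (hnext : ¬ HasSmoothExtensionPast ν 0 u T) (c : ℝ) :
    ∃ T₁ ∈ Ico 0 T, ∀ t ∈ Ioo T₁ T, ENNReal.ofReal c < eLpNorm (u t) 3 volume := by
  obtain ⟨l, hl, hsub⟩ := mem_nhdsLT_iff_exists_Ioo_subset.1
    (eventually_lt_eLpNorm_three_of_blowup hν hT hcl hLH hdec hnext
      (K := ENNReal.ofReal c) ENNReal.ofReal_lt_top)
  refine ⟨max l 0, ⟨le_max_right _ _, max_lt hl hT⟩, fun t ht => ?_⟩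
  exact hsub ⟨lt_of_le_of_lt (le_max_left _ _) ht.1, ht.2⟩

/-- The floor of `stub_l3RateFloor` at exponent `0`, literally (`(T-t)^{-0} = 1`): for every `c` there
is a final window on which `ofReal (c · (T-t)^{-(0:ℝ)}) ≤ ‖u(t)‖₃` (Seregin 2012, Thm. 1.1).
[cite: Seregin2012CMP, Thm. 1.1] -/
theorem l3Floor_exponent_zero_of_blowup (hν : 0 < ν) (hT : 0 < T)
    (hcl : IsClassicalNSSolutionOn (Ico 0 T) ν 0 u p) (hLH : IsLerayHopfOn T ν 0 (u 0) u)
    (hdec : HasRapidSpatialDecay (u 0)) (hnext : ¬ HasSmoothExtensionPast ν 0 u T) (c : ℝ) :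
    ∃ T₁ < T, ∀ t ∈ Ioo T₁ T,
      ENNReal.ofReal (c * (T - t) ^ (-(0 : ℝ))) ≤ eLpNorm (u t) 3 volume := by
  obtain ⟨T₁, hT₁, hwin⟩ := exists_window_lt_eLpNorm_three_of_blowup hν hT hcl hLH hdec hnext c
  refine ⟨T₁, hT₁.2, fun t ht => ?_⟩
  rw [neg_zero, Real.rpow_zero, mul_one]
  exact (hwin t ht).le

/-! ## §2  Escauriaza–Seregin–Šverák in the frame -/

/-- **Seregin's criterion, contrapositive (liminf form)**: if `‖u(t)‖₃ ≤ K < ∞` FREQUENTLY as `t ↑ T`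
(`liminf_{t↑T} ‖u(t)‖₃ < ∞`), the frame solution extends smoothly past `T` (Seregin 2012, Thm. 1.1; the
`limsup` version is Escauriaza–Seregin–Šverák 2003, Thms. 1.3–1.4).  Classical contrapositive of
`tendsto_eLpNorm_three_of_blowup`. [cite: Seregin2012CMP, Thm. 1.1] [cite: EscauriazaSereginSverak2003, Thms. 1.3–1.4] -/
theorem hasSmoothExtensionPast_of_frequently_eLpNorm_three_le (hν : 0 < ν) (hT : 0 < T)
    (hcl : IsClassicalNSSolutionOn (Ico 0 T) ν 0 u p) (hLH : IsLerayHopfOn T ν 0 (u 0) u)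
    (hdec : HasRapidSpatialDecay (u 0)) {K : ℝ≥0∞} (hK : K < ∞)
    (hfreq : ∃ᶠ t in 𝓝[<] T, eLpNorm (u t) 3 volume ≤ K) : HasSmoothExtensionPast ν 0 u T := by
  by_contra hnext
  obtain ⟨t, ht₁, ht₂⟩ :=
    (hfreq.and_eventually (eventually_lt_eLpNorm_three_of_blowup hν hT hcl hLH hdec hnext hK)).exists
  exact absurd ht₁ (not_le.2 ht₂)

/-- **ESS on a final window**: a frame solution with `‖u(t)‖_{L³} ≤ K < ∞` for all `t` of some final
window `(T₂, T)` extends smoothly past `T` (Escauriaza–Seregin–Šverák 2003, Thms. 1.3–1.4, through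
Seregin 2012, Thm. 1.1).  Every left-neighbourhood of `T` meets the window, so the bound holds frequently.
[cite: EscauriazaSereginSverak2003, Thms. 1.3–1.4] [cite: Seregin2012CMP, Thm. 1.1] -/
theorem hasSmoothExtensionPast_of_eLpNorm_three_le_near (hν : 0 < ν) (hT : 0 < T)
    (hcl : IsClassicalNSSolutionOn (Ico 0 T) ν 0 u p) (hLH : IsLerayHopfOn T ν 0 (u 0) u)
    (hdec : HasRapidSpatialDecay (u 0)) {T₂ : ℝ} (hT₂ : T₂ < T) {K : ℝ≥0∞} (hK : K < ∞)
    (hwin : ∀ t ∈ Ioo T₂ T, eLpNorm (u t) 3 volume ≤ K) : HasSmoothExtensionPast ν 0 u T := by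
  refine hasSmoothExtensionPast_of_frequently_eLpNorm_three_le hν hT hcl hLH hdec hK ?_
  have hmem : ∀ᶠ t in 𝓝[<] T, t ∈ Ioo T₂ T := Ioo_mem_nhdsLT hT₂
  exact (hmem.mono fun t ht => hwin t ht).frequently

/-- On a window where `u ∈ L^∞(T₂,T; L³)` (the tree's guarded class `MemLqLp ∞ 3 u (Ioo T₂ T)`), almost
every slice obeys `‖u(t)‖₃ ≤ ‖u‖_{L^∞(T₂,T;L³)} < ∞` (Serrin 1963, §3: unfolding the essential supremum
of the mixed norm; the junk value of `toReal` is harmless because a.e. slice is an `L³` field). [folklore] -/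
theorem ae_eLpNorm_three_le_of_memLqLp_top {T₂ : ℝ} (h : MemLqLp ∞ 3 u (Ioo T₂ T)) :
    ∀ᵐ t ∂(volume.restrict (Ioo T₂ T)), eLpNorm (u t) 3 volume ≤ eLqLpNorm ∞ 3 u (Ioo T₂ T) := by
  obtain ⟨hmem, -⟩ := h
  rw [eLqLpNorm_def, eLpNorm_exponent_top]
  filter_upwards [enorm_ae_le_eLpNormEssSup (fun t => (eLpNorm (u t) 3 volume).toReal)
    (volume.restrict (Ioo T₂ T)), hmem] with t ht h3
  calc eLpNorm (u t) 3 volume = ENNReal.ofReal (eLpNorm (u t) 3 volume).toReal :=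
        (ENNReal.ofReal_toReal h3.eLpNorm_ne_top).symm
    _ = ‖(eLpNorm (u t) 3 volume).toReal‖ₑ := (Real.enorm_eq_ofReal ENNReal.toReal_nonneg).symm
    _ ≤ _ := ht

/-- **ESS in the Ladyzhenskaya–Prodi–Serrin currency**: a frame solution with `u ∈ L^∞(T₂, T; L³(ℝ³))` on
some final window (`MemLqLp ∞ 3 u (Ioo T₂ T)`, `T₂ < T`) extends smoothly past `T`
(Escauriaza–Seregin–Šverák 2003, Thms. 1.3–1.4 = the tree's `ess_endpoint_holds` on `(0,T)`; here on a
final window and read off Seregin's limit: the essential bound holds on a set of positive measure inside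
every left-neighbourhood of `T`, hence frequently).
[cite: EscauriazaSereginSverak2003, Thms. 1.3–1.4] [cite: Seregin2012CMP, Thm. 1.1] -/
theorem hasSmoothExtensionPast_of_memLqLp_top_three_near (hν : 0 < ν) (hT : 0 < T)
    (hcl : IsClassicalNSSolutionOn (Ico 0 T) ν 0 u p) (hLH : IsLerayHopfOn T ν 0 (u 0) u)
    (hdec : HasRapidSpatialDecay (u 0)) {T₂ : ℝ} (hT₂ : T₂ < T) (h : MemLqLp ∞ 3 u (Ioo T₂ T)) :
    HasSmoothExtensionPast ν 0 u T := by
  set K : ℝ≥0∞ := eLqLpNorm ∞ 3 u (Ioo T₂ T) with hKdef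
  have hK : K < ∞ := h.2
  refine hasSmoothExtensionPast_of_frequently_eLpNorm_three_le hν hT hcl hLH hdec hK ?_
  have hae := ae_eLpNorm_three_le_of_memLqLp_top (u := u) (T := T) h
  -- frequently: every `Ioo l T`, `l < T`, meets the window in a set of positive measure
  rw [Filter.Frequently]
  intro hev
  obtain ⟨l, hl, hsub⟩ := mem_nhdsLT_iff_exists_Ioo_subset.1 hev
  haveI : (ae (volume.restrict (Ioo (max l T₂) T))).NeBot := by
    rw [ae_neBot, Ne, Measure.restrict_eq_zero, Real.volume_Ioo, ENNReal.ofReal_eq_zero, not_le]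
    exact sub_pos.2 (max_lt hl hT₂)
  obtain ⟨t, ht₁, ht₂⟩ :=
    ((ae_restrict_of_ae_restrict_of_subset (Ioo_subset_Ioo_left (le_max_right l T₂)) hae).and
      (ae_restrict_of_forall_mem measurableSet_Ioo fun t ht =>
        hsub (Ioo_subset_Ioo_left (le_max_left l T₂) ht))).exists
  exact ht₂ ht₁

/-- **Blow-up reading**: at a frame blow-up, `u ∉ L^∞(T₂, T; L³)` for EVERY `T₂ < T`
(Escauriaza–Seregin–Šverák 2003, Thms. 1.3–1.4). [cite: EscauriazaSereginSverak2003, Thms. 1.3–1.4] -/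
theorem not_memLqLp_top_three_near_of_blowup (hν : 0 < ν) (hT : 0 < T)
    (hcl : IsClassicalNSSolutionOn (Ico 0 T) ν 0 u p) (hLH : IsLerayHopfOn T ν 0 (u 0) u)
    (hdec : HasRapidSpatialDecay (u 0)) (hnext : ¬ HasSmoothExtensionPast ν 0 u T)
    {T₂ : ℝ} (hT₂ : T₂ < T) : ¬ MemLqLp ∞ 3 u (Ioo T₂ T) := fun h =>
  hnext (hasSmoothExtensionPast_of_memLqLp_top_three_near hν hT hcl hLH hdec hT₂ h)

/-! ## §3  The rung: `SupercriticalSerrinL3` at `p = ∞` -/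

/-- **RUNG `p = ∞` of the residual crux `SupercriticalSerrinL3` (PROVED).**  The crux's text with the
time-integrability exponent `p ∈ (4,5)` replaced by `p = ∞`: every classical solution on `[0,T)` that is
Leray–Hopf from a rapidly decaying datum and lies in `L^∞(T₂, T; L³(ℝ³))` on some final window extends
smoothly past `T` — Escauriaza–Seregin–Šverák 2003, Thms. 1.3–1.4, in the route's exact frame.  The crux
is the strengthening `∞ ↦ p < 5` of this theorem (`rung_top_of_supercriticalSerrinL3`).
[cite: EscauriazaSereginSverak2003, Thms. 1.3–1.4] [cite: Seregin2012CMP, Thm. 1.1] -/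
theorem supercriticalSerrinL3_rung_top :
    ∀ (ν T : ℝ), 0 < ν → 0 < T →
      ∀ (u : ℝ → EuclideanSpace ℝ (Fin 3) → EuclideanSpace ℝ (Fin 3)) (p : ℝ → EuclideanSpace ℝ (Fin 3) → ℝ),
        IsClassicalNSSolutionOn (Ico 0 T) ν 0 u p → IsLerayHopfOn T ν 0 (u 0) u →
        HasRapidSpatialDecay (u 0) → (∃ T₂ ∈ Ioo 0 T, MemLqLp ∞ 3 u (Ioo T₂ T)) →
        HasSmoothExtensionPast ν 0 u T := by
  intro ν T hν hT u p hcl hLH hdec hwin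
  obtain ⟨T₂, hT₂, h⟩ := hwin
  exact hasSmoothExtensionPast_of_memLqLp_top_three_near hν hT hcl hLH hdec hT₂.2 h

/-- An `L^∞(T₂,T; L³)` window bound gives the crux's `L^p(T₂,T; L³)` window hypothesis for every real
`q ≥ 0`: `∫_{T₂}^{T} ‖u(t)‖₃^q dt ≤ (T - T₂) · ‖u‖^q_{L^∞(T₂,T;L³)} < ∞` (Serrin 1963, §3, nesting of the
classes on a finite window). [folklore] -/
theorem lintegral_rpow_lt_top_of_memLqLp_top {T₂ : ℝ} (h : MemLqLp ∞ 3 u (Ioo T₂ T)) {q : ℝ}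
    (hq : 0 ≤ q) : (∫⁻ t in Ioo T₂ T, eLpNorm (u t) 3 volume ^ q) < ⊤ := by
  set K : ℝ≥0∞ := eLqLpNorm ∞ 3 u (Ioo T₂ T) with hKdef
  have hK : K < ∞ := h.2
  have hae := ae_eLpNorm_three_le_of_memLqLp_top (u := u) (T := T) h
  calc (∫⁻ t in Ioo T₂ T, eLpNorm (u t) 3 volume ^ q)
      ≤ ∫⁻ _t in Ioo T₂ T, K ^ q := lintegral_mono_ae (hae.mono fun t ht => by gcongr)
    _ = K ^ q * volume (Ioo T₂ T) := by rw [lintegral_const, Measure.restrict_apply_univ]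
    _ < ⊤ := by
        refine ENNReal.mul_lt_top (ENNReal.rpow_lt_top_of_nonneg hq hK.ne) ?_
        rw [Real.volume_Ioo]
        exact ENNReal.ofReal_lt_top

/-- **The crux implies the rung** (witness-of-weakness shape): `SupercriticalSerrinL3` (some `p < 5`)
yields the `p = ∞` statement, because an `L^∞` window bound is an `L^p` window bound on a finite window.
So the residual crux is a STRENGTHENING of the tree theorem `supercriticalSerrinL3_rung_top`. [folklore] -/
theorem rung_top_of_supercriticalSerrinL3 (h : SupercriticalSerrinL3) :
    ∀ (ν T : ℝ), 0 < ν → 0 < T →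
      ∀ (u : ℝ → EuclideanSpace ℝ (Fin 3) → EuclideanSpace ℝ (Fin 3)) (p : ℝ → EuclideanSpace ℝ (Fin 3) → ℝ),
        IsClassicalNSSolutionOn (Ico 0 T) ν 0 u p → IsLerayHopfOn T ν 0 (u 0) u →
        HasRapidSpatialDecay (u 0) → (∃ T₂ ∈ Ioo 0 T, MemLqLp ∞ 3 u (Ioo T₂ T)) →
        HasSmoothExtensionPast ν 0 u T := by
  obtain ⟨q, hq4, -, hcrit⟩ := h
  intro ν T hν hT u p hcl hLH hdec hwin
  obtain ⟨T₂, hT₂, hmem⟩ := hwin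
  exact hcrit ν T hν hT u p hcl hLH hdec
    ⟨T₂, hT₂, lintegral_rpow_lt_top_of_memLqLp_top hmem (by linarith)⟩

/-- **Blow-up branch of the pincer, endpoint reading**: on the blow-up branch (where the attacked conjunct
`L3CascadeJaw`/`EffSatBlowup` is demanded) the critical norm diverges, so a frame blow-up satisfying the
jaw `∫_{T₂}^{T} ‖u‖₃^q < ∞` does so with an UNBOUNDED integrand — the jaw is a statement about the PACE of
divergence only (Seregin 2012, Thm. 1.1). Recorded as: jaw at `q` on a window and blow-up ⇒ for every
level `c` the set of window times with `‖u(t)‖₃ > c` is a whole final sub-window. [cite: Seregin2012CMP, Thm. 1.1] -/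
theorem jaw_integrand_unbounded_of_blowup (hν : 0 < ν) (hT : 0 < T)
    (hcl : IsClassicalNSSolutionOn (Ico 0 T) ν 0 u p) (hLH : IsLerayHopfOn T ν 0 (u 0) u)
    (hdec : HasRapidSpatialDecay (u 0)) (hnext : ¬ HasSmoothExtensionPast ν 0 u T)
    {T₂ : ℝ} (hT₂ : T₂ < T) (c : ℝ) :
    ∃ T₁ ∈ Ico T₂ T, ∀ t ∈ Ioo T₁ T, ENNReal.ofReal c < eLpNorm (u t) 3 volume := by
  obtain ⟨T₁, hT₁, hwin⟩ := exists_window_lt_eLpNorm_three_of_blowup hν hT hcl hLH hdec hnext c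
  refine ⟨max T₁ T₂, ⟨le_max_right _ _, max_lt hT₁.2 hT₂⟩, fun t ht => ?_⟩
  exact hwin t ⟨lt_of_le_of_lt (le_max_left _ _) ht.1, ht.2⟩

end Summit.NavierStokesRegularity.NavierStokesRegularity.Theorems.L3TimeExponentPincerSerrinEndpointRung

end
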